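import Summits.HubbardSuperconductivity.HubbardSuperconductivity.Theorems.AnisotropyChordTransferFibre3L2TCell

/-!
# Route `AnisotropyChord` / H0 rotor rung, LEVEL 2 row `N₁`, t-BLOCK `64 ≤ L ≤ 95`: the block cell of the column
# `ν ∈ [0.026471, 0.027]` and its twelve kernel certificates

The `L2.TCell` (`…Fibre3L2TCell`) of the `ν`-column `[26471, 27000]/10⁶` for the t-block `L ∈ [64, 95]` of the range
`48 ≤ L < 128` (route-lead ruling R1): t-slot `[437433/100000000, 481917/50000000]` (`⌊(2·piLo/95)²⌋`, `⌈(2·piHi/64)²⌉` to `10⁻⁸`),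
`T = 964/10⁵ ≥ θ₀²`, window `K = 16`, and the twelve brackets of the normalised named sums
(`θ⁴S₂ ∈ [6.27285, 6.38198]`, …, `θ⁴Tx(1,1) ∈ [4.10888, 4.37906]`;
exact mirror `b1certG.py` of `B1.cellCheck 64` / `B1.txCellCheckG 64`), ★ `tcB064N26471_check` by one kernel `decide`.  The cell
files `…N1RowTa/TbB064N26471C….lean` of this column import it.
Prover seat `hubbard-h0-rotor-p2` g8; helper for piece A = stmt-HubbardSuperconductivity-23918 of rung 19089
(`--supports`, helper class).  Nothing here proves superconductivity in the Hubbard model; one kernel-certified piece of ONE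
conditional reduction (the GM₃ ∀L certificate, Level-2 row `N₁`, t-blocks `48 ≤ L < 128`, route-lead ruling R1); the rotor
TARGET as originally worded stays FALSE (g15 verdict).  Mathlib + the tree only; no sorry.  Generated by p2 g8's
scratch/tcells/mkcellT.py (copy in HOME/hubbard-h0-rotor-p2/scratch-g8/).
-/

set_option linter.dupNamespace false
set_option autoImplicit false

namespace Summit.HubbardSuperconductivity.HubbardSuperconductivity.Theorems.AnisotropyChord.Transfer.Fibre3.L2.N1

open Summit.HubbardSuperconductivity.HubbardSuperconductivity.Theorems.AnisotropyChord.Transfer.Fibre3.L2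

/-- the block cell of the column `ν ∈ [26471, 27000]/10⁶`, block `64 ≤ L ≤ 95`. -/
def tcB064N26471 : L2.TCell :=
  { L0 := 64,
    L1 := 95,
    tlo := 437433/100000000,
    thi := 481917/50000000,
    n1 := 26471,
    n2 := 27000,
    νd := 1000000,
    Tn := 964,
    Td := 100000,
    D := 1000000,
    bS2 := (1568213/250000, 6381976159/1000000000),
    bS3 := (1254191/250000, 5040042193/1000000000),
    bS4 := (47489/10000, 95520509/20000000),
    bT10 := (381157/100000, 3937889129/1000000000),
    bT11 := (1062637/250000, 4379057129/1000000000),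
    bG21 := (2178337/1000000, 1095483407/500000000),
    bG12 := (2178337/1000000, 1095483407/500000000),
    bG22 := (638203/500000, 1284691747/1000000000),
    bG31 := (867273/500000, 1745502747/1000000000),
    bG13 := (867273/500000, 1745502747/1000000000),
    bTx10 := (3668896871/1000000000, 3937889129/1000000000),
    bTx11 := (4108878871/1000000000, 4379057129/1000000000) }

/-- ★ the twelve kernel certificates (and the t-slot scales) of the column hold. -/
theorem tcB064N26471_check : tcB064N26471.check = true := by decide +kernel

end Summit.HubbardSuperconductivity.HubbardSuperconductivity.Theorems.AnisotropyChord.Transfer.Fibre3.L2.N1
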